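import Summits.BirchSwinnertonDyer.BirchSwinnertonDyer.Theorems.PrintCf2RubinValueTwoTowerLiftArithmetic
import HarnessLib

/-!
# Route C `PrintCf2RubinValueTwo`, crux `RestrictedMainConjWithValueAtTwo` (stmt-BirchSwinnertonDyer-23722), brick (RES)(b1) —
# GREENBERG'S LEMMA 3.2 IN THE TOWER DIRECTION: for a generator pair `(κ₁, κ₂; γ₁, γ₂)` and a discrete `p`-primary `M` with continuous
# orbits, the restriction `H¹(K_∞^{(2)}, M) → H¹(K̃_∞, M)` is ONTO the `γ₁`-invariant classes (`H²(ℤ_p, M^{Gal(K̄/K̃_∞)}) = 0` made explicit)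

Cell `bsd-print-cf2`, width seat `bsd-line-cf2c-w8` g0 (prover-bsd-line-cf2c-w8-g0-0); `--supports stmt-BirchSwinnertonDyer-23722`. Second file of
the port of the tree's `IwasawaSelmerControlCokerProofs` (`ZpExtension.exists_extend`, `mem_range_resOfLe_of_conjH1_eq`: the LAYER version) to
the pair `pairKer κ₁ κ₂ ≤ ker κ₂` (coordinate `κ₁`, generator `γ₁`; arithmetic in `…TowerLiftArithmetic`, p684214). This is the GLOBAL half of
the cokernel of control of brick (RES) (p683924 displays `Finite (I ⧸ g(𝔖))`; with this file, `I ⧸ g(𝔖)` is the purely LOCAL defect: every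
`γ₁`-invariant class of `H¹_nr(K̃_∞, M)` is the restriction of SOME class over `K_∞^{(2)}`, and what remains is whether that class satisfies
Agboola's local conditions — strict above `v̄`, locally trivial away from `p`). HONEST FRAMING: nothing here closes the crux or the registered
stub; BSD is not proved by any of this; no summit statement is proved by this seat. No definition (the would-be extension function is a local
`let` of the one proof), no named fact, no `sorry`. Generic: any field `K` of characteristic `0`, any prime `p`.
* `exists_extend_right` — a continuous cocycle `c` on `Gal(K̄/K̃_∞) = pairKer κ₁ κ₂` whose class is fixed by `γ₁`
  (`γ₁ c(γ₁⁻¹ τ γ₁) − c(τ) = τ m − m`) is the restriction of a continuous cocycle on `Gal(K̄/K_∞^{(2)}) = ker κ₂`: extend to the dense monoid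
  `S = {γ₁^k τ}` by `F(k, τ) = s_k + γ₁^k c(τ)` (tree `LayerCocycle.pairF`), prove automatic continuity from `p`-primarity of `M` and the
  `p`-adic topology of `ker κ₂ / pairKer ≅ ℤ_p` (an element `u = γ₁^{p^A} τ_a` of `S` inside a small open normal subgroup `V`, `p^f F(u) = 0`,
  kills `F` on `S ∩ V ∩ κ₁⁻¹(p^{A+f}ℤ_p)`), and descend along `ker κ₂ = S · V_f`.
* `mem_range_resOfLe_pairKer_right_of_conjH1_eq` — hence `res : H¹(ker κ₂, M) → H¹(pairKer κ₁ κ₂, M)` hits every class fixed by `conj_{γ₁}`.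
presearch: Greenberg LNM 1716 §3 Lemma 3.2; Serre *Galois Cohomology* I §2.6, §3.4 (`cd_p ℤ_p = 1`) — held; port of tree theorems, no new fact.

References: [GreenbergLNM1716] §3 Lemma 3.2; [SerreGaloisCohomology1997] I §2.6, §3.4, §5.1; [Rubin1991] §4; [Agboola2007] §3 Prop. 3.2.
-/

noncomputable section

open scoped Classical

set_option autoImplicit false

open Literature.NumberTheory.EllipticCurves Literature.NumberTheory.GaloisRepresentations
  Literature.NumberTheory.EllipticCurves.LayerCocycle

universe u

namespace Literature.NumberTheory.EllipticCurves.ZpExtension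

variable {K : Type u} [Field K] [CharZero K] {p : ℕ} [Fact p.Prime] {κ₁ κ₂ : ZpExtension K p}
  {γ₁ γ₂ : Field.absoluteGaloisGroup K}
  {M : Type u} [AddCommGroup M] [DistribMulAction (Field.absoluteGaloisGroup K) M] [TopologicalSpace M] [DiscreteTopology M]

omit [CharZero K] [TopologicalSpace M] [DiscreteTopology M] in
/-- `γ₁^{-k} τ γ₁^k ∈ pairKer` for `τ ∈ pairKer` (normality). [folklore] -/
theorem conj_pow_mem_pairKer (k : ℕ) {τ : Field.absoluteGaloisGroup K} (hτ : τ ∈ pairKer κ₁ κ₂) :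
    (γ₁ ^ k)⁻¹ * τ * γ₁ ^ k ∈ pairKer κ₁ κ₂ := by
  have h := (inferInstance : (pairKer κ₁ κ₂).Normal).conj_mem τ hτ (γ₁ ^ k)⁻¹
  rwa [inv_inv] at h

omit [CharZero K] [TopologicalSpace M] [DiscreteTopology M] in
/-- Coordinates on the monoid `S = {γ₁^k τ : τ ∈ pairKer}` are unique: `γ₁^k τ = γ₁^{k'} τ'` forces `k = k'` and `τ = τ'`. [folklore] -/
theorem pow_mul_inj_pair (hγ : IsTopGeneratorPair κ₁ κ₂ γ₁ γ₂) {k k' : ℕ} {τ τ' : Field.absoluteGaloisGroup K}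
    (hτ : τ ∈ pairKer κ₁ κ₂) (hτ' : τ' ∈ pairKer κ₁ κ₂) (h : γ₁ ^ k * τ = γ₁ ^ k' * τ') : k = k' ∧ τ = τ' := by
  have hk : k = k' := eq_of_map_pow_mul_eq_pair hγ hτ hτ' (congrArg κ₁ h)
  subst hk
  exact ⟨rfl, mul_left_cancel h⟩

/-- **Extension of a `γ₁`-invariant cocycle from `Gal(K̄/K̃_∞)` to `Gal(K̄/K_∞^{(2)})`** (Greenberg's Lemma 3.2, tower direction, on cocycles).
Let `(κ₁, κ₂; γ₁, γ₂)` be a generator pair, `M` a discrete `p`-primary `Γ_K`-module with continuous orbit maps, `c` a continuous cocycle on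
`pairKer κ₁ κ₂` and `m ∈ M` with `γ₁ c(γ₁⁻¹ τ γ₁) − c(τ) = τ m − m` (the class of `c` is fixed by `γ₁`). Then `c` is the restriction of a
continuous cocycle on `ker κ₂`: `b(s v) = F(s)` for `s = γ₁^k τ ∈ S`, `v ∈ V_f` — the explicit vanishing of the obstruction in
`H²(ker κ₂ / pairKer, M^{pairKer}) = H²(ℤ_p, B) = 0`. Port of the tree's `ZpExtension.exists_extend` (layers of one line) to the pair.
[cite: GreenbergLNM1716, §3 Lemma 3.2] [cite: SerreGaloisCohomology1997, I §2.6 and §3.4] -/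
theorem exists_extend_right (hγ : IsTopGeneratorPair κ₁ κ₂ γ₁ γ₂)
    (hcont : ∀ m : M, Continuous fun g : Field.absoluteGaloisGroup K ↦ g • m) (hprim : ∀ m : M, ∃ k : ℕ, p ^ k • m = 0)
    (c : contOneCocycles (discreteTopRep (pairKer κ₁ κ₂) M)) (m : M)
    (hm : ∀ τ : pairKer κ₁ κ₂, γ₁ • c.1 (subgroupConj (pairKer κ₁ κ₂) γ₁ τ) - c.1 τ = (τ : Field.absoluteGaloisGroup K) • m - m) :
    ∃ b : contOneCocycles (discreteTopRep κ₂.kerSubgroup M),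
      ∀ (τ : Field.absoluteGaloisGroup K) (hτ : τ ∈ pairKer κ₁ κ₂), b.1 ⟨τ, pairKer_le_right κ₁ κ₂ hτ⟩ = c.1 ⟨τ, hτ⟩ := by
  -- the monoid `S = {γ₁^k τ}` and the would-be extension `ext (γ₁^k τ) = F(k, τ) = s_k + γ₁^k c(τ)`
  let InS : Field.absoluteGaloisGroup K → Prop := fun g ↦ ∃ kτ : ℕ × Field.absoluteGaloisGroup K, kτ.2 ∈ (pairKer κ₁ κ₂) ∧ g = γ₁ ^ kτ.1 * kτ.2
  have inS_pow_mul : ∀ (k : ℕ) {τ : Field.absoluteGaloisGroup K}, τ ∈ (pairKer κ₁ κ₂) → InS (γ₁ ^ k * τ) := fun k τ hτ ↦ ⟨(k, τ), hτ, rfl⟩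
  have inS_of_mem : ∀ {τ : Field.absoluteGaloisGroup K}, τ ∈ (pairKer κ₁ κ₂) → InS τ := fun {τ} hτ ↦ ⟨(0, τ), hτ, by rw [pow_zero, one_mul]⟩
  have inS_mul : ∀ {g g' : Field.absoluteGaloisGroup K}, InS g → InS g' → InS (g * g') := by
    rintro g g' ⟨⟨j, τ⟩, hτ, rfl⟩ ⟨⟨k, τ'⟩, hτ', rfl⟩
    exact ⟨(j + k, (γ₁ ^ k)⁻¹ * τ * γ₁ ^ k * τ'), mul_mem (conj_pow_mem_pairKer k hτ) hτ', by dsimp only; rw [pow_add]; group⟩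
  have inS_pow : ∀ {g : Field.absoluteGaloisGroup K}, InS g → ∀ N : ℕ, InS (g ^ N) := by
    intro g hg N
    induction N with
    | zero => rw [pow_zero]; exact inS_of_mem (one_mem _)
    | succ N ih => rw [pow_succ]; exact inS_mul ih hg
  let ext : Field.absoluteGaloisGroup K → M := fun g ↦
    if h : InS g then pairF (pairKer κ₁ κ₂) γ₁ m c h.choose.1 ⟨h.choose.2, h.choose_spec.1⟩ else 0
  have ext_eq : ∀ (k : ℕ) {τ : Field.absoluteGaloisGroup K} (hτ : τ ∈ (pairKer κ₁ κ₂)), ext (γ₁ ^ k * τ) = pairF (pairKer κ₁ κ₂) γ₁ m c k ⟨τ, hτ⟩ := by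
    intro k τ hτ
    have h : InS (γ₁ ^ k * τ) := inS_pow_mul k hτ
    show (if h : InS (γ₁ ^ k * τ) then pairF (pairKer κ₁ κ₂) γ₁ m c h.choose.1 ⟨h.choose.2, h.choose_spec.1⟩ else 0) = _
    rw [dif_pos h]
    obtain ⟨hτ', heq⟩ := h.choose_spec
    obtain ⟨hk, hτeq⟩ := pow_mul_inj_pair hγ hτ' hτ heq.symm
    have key : ∀ (k' : ℕ) (τ' : Field.absoluteGaloisGroup K) (h' : τ' ∈ (pairKer κ₁ κ₂)), k' = k → τ' = τ →
        pairF (pairKer κ₁ κ₂) γ₁ m c k' ⟨τ', h'⟩ = pairF (pairKer κ₁ κ₂) γ₁ m c k ⟨τ, hτ⟩ := by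
      rintro k' τ' h' rfl rfl
      rfl
    exact key _ _ _ hk hτeq
  have ext_of_mem : ∀ {τ : Field.absoluteGaloisGroup K} (hτ : τ ∈ (pairKer κ₁ κ₂)), ext τ = c.1 ⟨τ, hτ⟩ := by
    intro τ hτ
    have h := ext_eq 0 hτ
    rwa [pow_zero, one_mul, pairF_zero] at h
  have ext_one : ext 1 = 0 := by rw [ext_of_mem (one_mem _)]; exact contOneCocycles.apply_one c
  have ext_mul : ∀ {g g' : Field.absoluteGaloisGroup K}, InS g → InS g' → ext (g * g') = ext g + g • ext g' := by
    rintro g g' ⟨⟨j, τ⟩, hτ, rfl⟩ ⟨⟨k, τ'⟩, hτ', rfl⟩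
    dsimp only
    have hconj := conj_pow_mem_pairKer (κ₁ := κ₁) (κ₂ := κ₂) (γ₁ := γ₁) k hτ
    have e : γ₁ ^ j * τ * (γ₁ ^ k * τ') = γ₁ ^ (j + k) * ((γ₁ ^ k)⁻¹ * τ * γ₁ ^ k * τ') := by rw [pow_add]; group
    rw [e, ext_eq (j + k) (mul_mem hconj hτ'), ext_eq j hτ, ext_eq k hτ']
    have e2 : (⟨(γ₁ ^ k)⁻¹ * τ * γ₁ ^ k * τ', mul_mem hconj hτ'⟩ : (pairKer κ₁ κ₂)) = subgroupConj (pairKer κ₁ κ₂) (γ₁ ^ k) ⟨τ, hτ⟩ * ⟨τ', hτ'⟩ :=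
      Subtype.ext rfl
    rw [e2, pairF_mul (pairKer κ₁ κ₂) γ₁ m c hm j k]
  -- Step A: the small open normal subgroup `V`
  obtain ⟨V, hVN, hVo, hVm, hVc, hVZ⟩ := exists_good_subgroup_pairKer κ₁ κ₂ hcont c m
  haveI := hVN
  have smul_ext : ∀ {v : Field.absoluteGaloisGroup K}, v ∈ V → ∀ {g : Field.absoluteGaloisGroup K}, InS g → v • ext g = ext g := by
    rintro v hv g ⟨⟨k, τ⟩, hτ, rfl⟩
    dsimp only
    rw [ext_eq k hτ]
    exact smul_pairF (pairKer κ₁ κ₂) γ₁ m c V hVm hVc hv k ⟨τ, hτ⟩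
  have ext_pow : ∀ {w : Field.absoluteGaloisGroup K}, InS w → w ∈ V → ∀ N : ℕ, ext (w ^ N) = N • ext w := by
    intro w hw hwV N
    induction N with
    | zero => rw [pow_zero, zero_nsmul, ext_one]
    | succ N ih => rw [pow_succ, ext_mul (inS_pow hw N) hw, ih, smul_ext (V.pow_mem hwV N) hw, succ_nsmul]
  -- Step C: `u = γ₁^{p^A} τa ∈ V ∩ S` and `f` with `p^f • ext u = 0`
  obtain ⟨A, hA⟩ := exists_forall_exists_toAdd_eq_pair hγ V hVo
  obtain ⟨u, huV, hu₂, hu⟩ := hA 1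
  have hτa : (γ₁ ^ p ^ A)⁻¹ * u ∈ (pairKer κ₁ κ₂) := by
    rw [mem_pairKer_iff]
    constructor
    · apply Multiplicative.toAdd.injective
      rw [map_mul, map_inv, toAdd_mul, toAdd_inv, toAdd_map_pow_left hγ, hu, toAdd_one, Nat.cast_pow, mul_one, neg_add_cancel]
    · exact mem_kerSubgroup.mp (κ₂.kerSubgroup.mul_mem (κ₂.kerSubgroup.inv_mem (pow_mem hγ.2.1 _)) hu₂)
  have hu_eq : γ₁ ^ p ^ A * ((γ₁ ^ p ^ A)⁻¹ * u) = u := mul_inv_cancel_left _ _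
  have huS : InS u := by rw [← hu_eq]; exact inS_pow_mul (p ^ A) hτa
  obtain ⟨f, hf⟩ := hprim (ext u)
  -- the deep open normal subgroup `V_f`
  set Vf : Subgroup (Field.absoluteGaloisGroup K) := V ⊓ κ₁.layerSubgroup (A + f) with hVf
  have hVfo : IsOpen (Vf : Set (Field.absoluteGaloisGroup K)) := by
    rw [hVf, Subgroup.coe_inf]
    exact hVo.inter (κ₁.isOpen_layerSubgroup _)
  have hVfN : Vf.Normal := Subgroup.normal_inf_normal V (κ₁.layerSubgroup (A + f))
  -- automatic continuity: `ext` vanishes on `S ∩ V_f`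
  have hvan : ∀ {w : Field.absoluteGaloisGroup K}, InS w → w ∈ Vf → ext w = 0 := by
    rintro w ⟨⟨k, τ⟩, hτ, rfl⟩ hwV
    dsimp only at hwV ⊢
    obtain ⟨j, hj⟩ := pow_dvd_of_pow_mul_mem_layerSubgroup hγ (A + f) k hτ hwV.2
    set N : ℕ := j * p ^ f with hN
    have hw' : (u ^ N)⁻¹ * (γ₁ ^ k * τ) ∈ (pairKer κ₁ κ₂) := by
      rw [mem_pairKer_iff]
      constructor
      · apply Multiplicative.toAdd.injective
        rw [map_mul, map_inv, map_pow κ₁, toAdd_mul, toAdd_inv, toAdd_pow, toAdd_map_pow_mul_pair hγ k hτ, hu, toAdd_one, hj, hN,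
          nsmul_eq_mul]
        push_cast
        ring
      · exact mem_kerSubgroup.mp (κ₂.kerSubgroup.mul_mem (κ₂.kerSubgroup.inv_mem (κ₂.kerSubgroup.pow_mem hu₂ N))
          (pow_mul_mem_kerSubgroup_right hγ k hτ))
    have e : γ₁ ^ k * τ = u ^ N * ((u ^ N)⁻¹ * (γ₁ ^ k * τ)) := by rw [mul_inv_cancel_left]
    have hw'V : (u ^ N)⁻¹ * (γ₁ ^ k * τ) ∈ V := mul_mem (inv_mem (V.pow_mem huV N)) hwV.1
    rw [e, ext_mul (inS_pow huS N) (inS_of_mem hw'), ext_pow huS huV N, ext_of_mem hw', hVZ _ hw'V hw', smul_zero, add_zero, hN,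
      mul_nsmul', hf, nsmul_zero]
  -- independence of the representative
  have ext_eq_of_inv_mul_mem : ∀ {s s' : Field.absoluteGaloisGroup K}, InS s → InS s' → s⁻¹ * s' ∈ Vf → ext s = ext s' := by
    have aux : ∀ (k d : ℕ) (τ τ' : Field.absoluteGaloisGroup K), τ ∈ (pairKer κ₁ κ₂) → τ' ∈ (pairKer κ₁ κ₂) →
        (γ₁ ^ k * τ)⁻¹ * (γ₁ ^ (k + d) * τ') ∈ Vf → ext (γ₁ ^ k * τ) = ext (γ₁ ^ (k + d) * τ') := by
      intro k d τ τ' hτ hτ' hmem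
      have hw : InS ((γ₁ ^ k * τ)⁻¹ * (γ₁ ^ (k + d) * τ')) :=
        ⟨(d, (γ₁ ^ d)⁻¹ * τ⁻¹ * γ₁ ^ d * τ'), mul_mem (conj_pow_mem_pairKer d (inv_mem hτ)) hτ', by dsimp only; rw [pow_add]; group⟩
      have h2 := ext_mul (inS_pow_mul k hτ) hw
      rw [mul_inv_cancel_left, hvan hw hmem, smul_zero, add_zero] at h2
      exact h2.symm
    rintro s s' ⟨⟨k, τ⟩, hτ, rfl⟩ ⟨⟨k', τ'⟩, hτ', rfl⟩ h
    dsimp only at h ⊢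
    rcases le_total k k' with hle | hle
    · obtain ⟨d, rfl⟩ := Nat.exists_eq_add_of_le hle
      exact aux k d τ τ' hτ hτ' h
    · obtain ⟨d, rfl⟩ := Nat.exists_eq_add_of_le hle
      have h' : (γ₁ ^ k' * τ')⁻¹ * (γ₁ ^ (k' + d) * τ) ∈ Vf := by
        have := inv_mem h
        rwa [mul_inv_rev, inv_inv] at this
      exact (aux k' d τ' τ hτ' hτ h').symm
  -- covering `ker κ₂ = S · V_f`
  choose kx τx vx hτx hvx hx using fun x : κ₂.kerSubgroup ↦ exists_eq_pow_mul_mul_pair hγ Vf hVfo x.2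
  let bfun : κ₂.kerSubgroup → M := fun x ↦ ext (γ₁ ^ kx x * τx x)
  have hF2 : ∀ (x : κ₂.kerSubgroup) {s : Field.absoluteGaloisGroup K}, InS s → s⁻¹ * (x : Field.absoluteGaloisGroup K) ∈ Vf →
      bfun x = ext s := by
    intro x s hs hsx
    refine (ext_eq_of_inv_mul_mem hs (inS_pow_mul (kx x) (hτx x)) ?_).symm
    have e : s⁻¹ * (γ₁ ^ kx x * τx x) = s⁻¹ * (x : Field.absoluteGaloisGroup K) * (vx x)⁻¹ := by
      conv_lhs => rw [show γ₁ ^ kx x * τx x = (x : Field.absoluteGaloisGroup K) * (vx x)⁻¹ by rw [hx x, mul_inv_cancel_right]]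
      rw [mul_assoc]
    rw [e]
    exact mul_mem hsx (inv_mem (hvx x))
  have hF3 : ∀ x y : κ₂.kerSubgroup, (x : Field.absoluteGaloisGroup K)⁻¹ * y ∈ Vf → bfun y = bfun x := by
    intro x y hxy
    refine hF2 y (inS_pow_mul (kx x) (hτx x)) ?_
    have e : (γ₁ ^ kx x * τx x)⁻¹ * (y : Field.absoluteGaloisGroup K) = vx x * ((x : Field.absoluteGaloisGroup K)⁻¹ * y) := by
      conv_lhs => rw [show γ₁ ^ kx x * τx x = (x : Field.absoluteGaloisGroup K) * (vx x)⁻¹ by rw [hx x, mul_inv_cancel_right]]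
      group
    rw [e]
    exact mul_mem (hvx x) hxy
  have hcontb : Continuous bfun := by
    refine IsLocallyConstant.continuous ((IsLocallyConstant.iff_exists_open bfun).mpr fun x ↦ ?_)
    refine ⟨{y | (x : Field.absoluteGaloisGroup K)⁻¹ * y ∈ Vf}, ?_, ?_, fun y hy ↦ hF3 x y hy⟩
    · exact hVfo.preimage (continuous_const.mul continuous_subtype_val)
    · show (x : Field.absoluteGaloisGroup K)⁻¹ * x ∈ Vf
      rw [inv_mul_cancel]
      exact one_mem _
  have hF4 : ∀ x y : κ₂.kerSubgroup, bfun (x * y) = bfun x + (x : Field.absoluteGaloisGroup K) • bfun y := by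
    intro x y
    have hst : InS ((γ₁ ^ kx x * τx x) * (γ₁ ^ kx y * τx y)) := inS_mul (inS_pow_mul (kx x) (hτx x)) (inS_pow_mul (kx y) (hτx y))
    have hmem : ((γ₁ ^ kx x * τx x) * (γ₁ ^ kx y * τx y))⁻¹ * ((x * y : κ₂.kerSubgroup) : Field.absoluteGaloisGroup K) ∈ Vf := by
      have e : ((γ₁ ^ kx x * τx x) * (γ₁ ^ kx y * τx y))⁻¹ * ((x * y : κ₂.kerSubgroup) : Field.absoluteGaloisGroup K) =
          (γ₁ ^ kx y * τx y)⁻¹ * vx x * (γ₁ ^ kx y * τx y) * vx y := by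
        rw [Subgroup.coe_mul]
        conv_lhs => rw [hx x, hx y]
        group
      rw [e]
      refine mul_mem ?_ (hvx y)
      have := hVfN.conj_mem (vx x) (hvx x) (γ₁ ^ kx y * τx y)⁻¹
      rwa [inv_inv] at this
    rw [hF2 (x * y) hst hmem, ext_mul (inS_pow_mul (kx x) (hτx x)) (inS_pow_mul (kx y) (hτx y))]
    have hv : vx x ∈ V := (hvx x).1
    have e3 : (x : Field.absoluteGaloisGroup K) • bfun y = (γ₁ ^ kx x * τx x) • bfun y := by
      conv_lhs => rw [hx x]
      rw [mul_smul, smul_ext hv (inS_pow_mul (kx y) (hτx y))]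
    rw [e3]
  refine ⟨⟨⟨bfun, hcontb⟩, fun x y ↦ hF4 x y⟩, fun τ hτ ↦ ?_⟩
  show bfun ⟨τ, pairKer_le_right κ₁ κ₂ hτ⟩ = c.1 ⟨τ, hτ⟩
  rw [hF2 ⟨τ, pairKer_le_right κ₁ κ₂ hτ⟩ (inS_of_mem hτ) (by rw [inv_mul_cancel]; exact one_mem _), ext_of_mem hτ]

/-- **Restriction `H¹(Gal(K̄/K_∞^{(2)}), M) → H¹(Gal(K̄/K̃_∞), M)` hits every class fixed by `conj_{γ₁}`** (`M` discrete `p`-primary with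
continuous orbit maps, `(κ₁, κ₂; γ₁, γ₂)` any generator pair): the cocycle-level extension `exists_extend_right`, transported through the explicit
description of `conjH1` and `resOfLe` on cocycles. With p683075 §2 (`conjSel₂_lineRes_right_of_mem`: restricted classes ARE `γ₁`-invariant) the
GLOBAL part of Agboola's control in the tower direction is EXACT: `im(res) = H¹(K̃_∞, M)^{γ₁}` on the full `H¹`; the cokernel of control of
(RES) is thereby reduced to the LOCAL conditions of a lift. [cite: GreenbergLNM1716, §3 Lemma 3.2] [cite: SerreGaloisCohomology1997, I §2.6]
[cite: Agboola2007, §3 Prop. 3.2] -/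
theorem mem_range_resOfLe_pairKer_right_of_conjH1_eq (hγ : IsTopGeneratorPair κ₁ κ₂ γ₁ γ₂)
    (hcont : ∀ m : M, Continuous fun g : Field.absoluteGaloisGroup K ↦ g • m) (hprim : ∀ m : M, ∃ k : ℕ, p ^ k • m = 0)
    (x : subgroupH1 (pairKer κ₁ κ₂) M) (hx : conjH1 (pairKer κ₁ κ₂) M γ₁ x = x) :
    x ∈ (resOfLe M (pairKer_le_right κ₁ κ₂)).range := by
  obtain ⟨c, rfl⟩ := oneCocycleClass_surjective _ x
  have hconj : conjH1 (pairKer κ₁ κ₂) M γ₁ (oneCocycleClass _ c) =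
      oneCocycleClass _ (contOneCocycles.pullback (subgroupConj (pairKer κ₁ κ₂) γ₁)
        (resHomOfEquivariant (subgroupConj (pairKer κ₁ κ₂) γ₁) (DistribSMul.toAddMonoidHom M γ₁)
          (conj_compat (pairKer κ₁ κ₂) γ₁)) c) :=
    map_oneCocycleClass _ _ _ c
  rw [hconj, ← sub_eq_zero, ← oneCocycleClass_sub, oneCocycleClass_eq_zero_iff] at hx
  obtain ⟨m, hm⟩ := hx
  have hm' : ∀ τ : pairKer κ₁ κ₂, γ₁ • c.1 (subgroupConj (pairKer κ₁ κ₂) γ₁ τ) - c.1 τ = (τ : Field.absoluteGaloisGroup K) • m - m := by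
    intro τ
    have h := hm τ
    rw [Submodule.coe_sub, ContinuousMap.sub_apply, contOneCocycles.pullback_apply] at h
    exact h
  obtain ⟨b, hb⟩ := exists_extend_right hγ hcont hprim c m hm'
  refine ⟨oneCocycleClass _ b, ?_⟩
  have hres : resOfLe M (pairKer_le_right κ₁ κ₂) (oneCocycleClass _ b) =
      oneCocycleClass _ (contOneCocycles.pullback (subgroupInclusion (pairKer_le_right κ₁ κ₂))
        (resHomOfEquivariant (subgroupInclusion (pairKer_le_right κ₁ κ₂)) (AddMonoidHom.id M) (fun _ _ ↦ rfl)) b) :=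
    map_oneCocycleClass _ _ _ b
  rw [hres]
  congr 1
  apply Subtype.ext
  ext τ
  rw [contOneCocycles.pullback_apply]
  exact hb τ τ.2

end Literature.NumberTheory.EllipticCurves.ZpExtension
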